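import Summits.HubbardSuperconductivity.HubbardSuperconductivity.Theorems.BalabanIRBirComplexStableXYRCoreSecondMoment
import Summits.HubbardSuperconductivity.HubbardSuperconductivity.Theorems.BalabanIRBirComplexStableXYRPositivityCore
import HarnessLib

/-!
# Route `BalabanIR`, crux `BirComplexStableXYR` (item `stmt-HubbardSuperconductivity-14845`),
# line `fat-gaussian-defect-calculus`: stub B2a `stub_actionConjNeg`

Helper (`--supports`) for the crux
`Summit.HubbardSuperconductivity.HubbardSuperconductivity.Theses.BalabanIR.BirComplexStableXYR`,
line `fat-gaussian-defect-calculus` (lead skeleton `Cruxes/BirComplexStableXYR/Lines/fat_gaussian_defect_calculus.lean`),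
stub B2a `stub_actionConjNeg`: **the window action is complex-conjugated by the lattice inversion `y ↦ −y`
of the space–time torus `Λ L M = (Fin 2 → ZMod L) × ZMod M` under (R) ∧ (P).**

**Statement.** For a window Fourier table `c : Table r` with (R) time-reflection Hermiticity
`c (n ∘ R) = conj (c (−n))` (`R w = (w.1, w.2.1, rev w.2.2)`) and (P) spatial-inversion evenness
`c (n ∘ P) = c n` (`P w = (rev w.1, rev w.2.1, w.2.2)`), every real `K`, all `L, M ≥ 1` and every field `θ`:
`action K c L M (θ ∘ neg) = conj (action K c L M θ)`.

**Proof.** `−y = σ₀ (ρ y)` with the time reflection `ρ (x,t) = (x, −t)` and the spatial inversion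
`σ₀ (x,t) = (0 − x, t)`.  Two landed facts are chained:
* (P) ⇒ the summed window functional is invariant under every spatial inversion `σ_a` of the torus
  (`CoreBL.sum_genF_sinv`, file `…RCoreSecondMoment`), applied to the time-reflected field `θ ∘ ρ` with `a = 0`;
* (R) ⇒ `action (θ ∘ ρ) = conj (action θ)` (`action_comp_timeReflection` with the table ⇒ functional bridge
  `timeReflection_functional_of_table`, file `…Reality`; its `let`-bound `sh`, `F`, `A` are verbatim
  `sh`, `genF`, `action`).
Elementary; no definition and no named fact is introduced; sorry-free. [folklore]
-/

set_option linter.dupNamespace false -- `Summit.<S>.<S>.Theorems…` repeats the summit name (D-0017 layout)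

namespace Summit.HubbardSuperconductivity.HubbardSuperconductivity.Theorems.FSUnfolding

open scoped BigOperators ComplexConjugate
open Literature.Probability.LatticeModels
open Summit.HubbardSuperconductivity.BirComplexStableXYNegative

/-- (R) ⇒ the window action is time-reflection Hermitian, in the `action` vocabulary of `WitnessTable`:
`action K c L M (θ ∘ ρ) = conj (action K c L M θ)` for `ρ (x,t) = (x,−t)` (this is
`action_comp_timeReflection`, whose `let`-bound `sh`/`F`/`A` unfold to `sh`/`genF`/`action`). [folklore] -/
theorem action_comp_timeReflection_eq_conj {r : ℕ} (K : ℝ) (c : Table r)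
    (hR : ∀ n : Freq r, c (fun w => n (w.1, w.2.1, Fin.rev w.2.2)) = conj (c (-n)))
    (L M : ℕ) [NeZero L] [NeZero M] (θ : Λ L M → ℝ) :
    action K c L M (fun y => θ (y.1, -y.2)) = conj (action K c L M θ) := by
  have h := action_comp_timeReflection r c K L M (timeReflection_functional_of_table r c hR) θ
  dsimp only at h
  dsimp only [action, genF, sh]
  exact h

/-- (P) ⇒ the window action is invariant under the spatial inversion through the origin composed with any
field: `action K c L M (y ↦ θ (−y.1, y.2)) = action K c L M θ` (`CoreBL.sum_genF_sinv` with `a = 0`). [folklore] -/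
theorem action_comp_spaceInversion_eq {r : ℕ} (K : ℝ) (c : Table r)
    (hP : ∀ n : Freq r, c (fun w => n (Fin.rev w.1, Fin.rev w.2.1, w.2.2)) = c n)
    (L M : ℕ) [NeZero L] [NeZero M] (θ : Λ L M → ℝ) :
    action K c L M (fun y => θ (-y.1, y.2)) = action K c L M θ := by
  have h := CoreBL.sum_genF_sinv c hP (0 : TorusSite 2 L) θ
  simp only [zero_sub] at h
  unfold action
  rw [h]

/-- **Stub B2a `stub_actionConjNeg` (registered signature, verbatim): the action is conjugated by the lattice
inversion under (R) ∧ (P).**  Time-reflection Hermiticity (R) and spatial inversion evenness (P) give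
`action K c L M (θ ∘ neg) = conj (action K c L M θ)` for every real `K`, all `L, M ≥ 1` and every field `θ`
on `Λ L M`: write `θ (−y) = (θ ∘ ρ) (−y.1, y.2)` with the time reflection `ρ (x,t) = (x,−t)`, remove the
spatial inversion by (P) (`action_comp_spaceInversion_eq`) and conjugate by (R)
(`action_comp_timeReflection_eq_conj`).  This is the symmetry pairing the vortex sectors `a ↔ a^J`
(term ↦ conj term) in chapter 2 of the line. [folklore] -/
theorem stub_actionConjNeg :
    ∀ (r : ℕ) (K : ℝ) (c : Table r),
      (∀ n : Freq r, c (fun w => n (w.1, w.2.1, Fin.rev w.2.2)) = (starRingEnd ℂ) (c (-n))) →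
      (∀ n : Freq r, c (fun w => n (Fin.rev w.1, Fin.rev w.2.1, w.2.2)) = c n) →
      ∀ (L M : ℕ) [NeZero L] [NeZero M] (θ : Λ L M → ℝ),
        action K c L M (fun y => θ (-y)) = (starRingEnd ℂ) (action K c L M θ) := by
  intro r K c hR hP L M _ _ θ
  -- `θ (-y) = (θ ∘ ρ) (-y.1, y.2)` with `ρ y = (y.1, -y.2)`
  have hneg : (fun y : Λ L M => θ (-y)) =
      fun y : Λ L M => (fun z : Λ L M => θ (z.1, -z.2)) (-y.1, y.2) := by
    funext y
    rfl
  rw [hneg, action_comp_spaceInversion_eq K c hP L M (fun z : Λ L M => θ (z.1, -z.2))]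
  exact action_comp_timeReflection_eq_conj K c hR L M θ

end Summit.HubbardSuperconductivity.HubbardSuperconductivity.Theorems.FSUnfolding
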